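import Summits.KontsevichZagierPeriods.KontsevichZagierPeriods.Theses.HyperbolicBloch
import Summits.KontsevichZagierPeriods.KontsevichZagierPeriods.Theorems.HyperbolicBlochFiveTermTransfer

/-!
# `FiveTermCalibration` (stmt-KontsevichZagierPeriods-3476) — the five-term instance `(x, y) = (i, 2i)`

The support item `HyperbolicBloch.FiveTermCalibration`: for any four Kontsevich–Zagier integral
representations `r₁, r₂, r₃, r₄` on the standard ideal tetrahedra `T(i)`, `T((3+i)/5)`, `T(2i)`,
`T((6+2i)/5)` (vertices `∞, 0, 1, z`, upper half-space model) with integrand the hyperbolic density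
`t⁻³` on their domains, the combination `[r₁] + [r₂] − [r₃] − [r₄]` is a relation of the KZ
calculus.

This is the instance `(x, y) = (i, 2i)` of the five-term relation in Neumann's form
`[x] − [y] + [y/x] − [(1 − x⁻¹)/(1 − y⁻¹)] + [(1 − x)/(1 − y)]` (Neumann 1998, (2.3)): here
`y / x = 2` is real (its term drops), `(1 − x⁻¹)/(1 − y⁻¹) = (6 + 2i)/5` and
`(1 − x)/(1 − y) = (3 + i)/5`.  Geometrically: the ideal pyramid with apex `1` over the flat ideal
quadrilateral `(∞, 0, i, 2i)`, split along either diagonal (a 4-concyclic configuration).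
Numerically `D(i) + D((3+i)/5) = 0.9159655942 + 0.5116663986 = 1.4276319927 =
0.8085983912 + 0.6190336015 = D(2i) + D((6+2i)/5)`.

Proof: the closed crux `FiveTermTransfer` (`FiveTerm.FiveTermTransfer_of`,
`Theorems/HyperbolicBlochFiveTermTransfer.lean`), unfolded by `fiveTermTransfer_iff` and applied to
the standard family `ρ₀` (`Theorems/FiveTermTransfer/Negative/LoadBearing.lean`) at `(i, 2i)`, gives
`[ρ₀ i] − [ρ₀ 2i] + 0 − [ρ₀ (6+2i)/5] + [ρ₀ (3+i)/5] ∈ relations`; each `rₖ` differs from the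
corresponding `ρ₀ zₖ` by a relation (`KZ.of_sub_of_mem_relations_of_eqOn`: same domain — the four
typed domains are `idealTetrahedron zₖ` with `Re zₖ, Im zₖ, |zₖ|²` evaluated — and integrands equal
to `t⁻³` on it).  No new definitions.

References: W. Neumann, *Hilbert's 3rd problem and invariants of 3-manifolds* (1998), §2 (2.3);
D. Zagier, *The dilogarithm function* (2007), Ch. I §3.
-/

noncomputable section

open Complex MeasureTheory Set
open scoped ComplexConjugate

namespace Summit.KontsevichZagierPeriods.HyperbolicBloch.Calibration

open Literature.NumberTheory.Transcendental
open Literature.NumberTheory.Transcendental.KZ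
open Summit.KontsevichZagierPeriods.KontsevichZagierPeriods.Theses.HyperbolicBloch (FiveTermCalibration)
open Summit.KontsevichZagierPeriods.HyperbolicBloch.FiveTermTransferNegative
open Summit.KontsevichZagierPeriods.HyperbolicBloch.FiveTerm (FiveTermTransfer_of)

/-! ## §1 The four typed domains are standard tetrahedra -/

/-- The standard tetrahedron `T(z)` for `z = a + b i`, with `Re z`, `Im z`, `|z|²` evaluated. [folklore] -/
theorem idealTetrahedron_mk (a b : ℝ) : idealTetrahedron ⟨a, b⟩ =
    {p | 0 < p 1 ∧ a * p 1 < b * p 0 ∧ b * (p 0 - 1) < (a - 1) * p 1 ∧ 0 < p 2 ∧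
      0 < b * (p 0 ^ 2 + p 1 ^ 2 + p 2 ^ 2 - p 0) + (a - (a * a + b * b)) * p 1} := by
  ext p
  simp only [idealTetrahedron, mem_setOf_eq, Complex.normSq_mk]

/-- `T(i)` is the first typed domain of the item. [folklore] -/
theorem idealTetrahedron_I : idealTetrahedron I =
    {p | 0 < p 1 ∧ 0 < p 0 ∧ p 0 - 1 < -p 1 ∧ 0 < p 2 ∧
      0 < p 0 ^ 2 + p 1 ^ 2 + p 2 ^ 2 - p 0 - p 1} := by
  rw [show (I : ℂ) = ⟨0, 1⟩ from rfl, idealTetrahedron_mk]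
  ext p
  simp only [mem_setOf_eq]
  constructor
  · rintro ⟨h1, h2, h3, h4, h5⟩
    exact ⟨h1, by linarith, by linarith, h4, by linarith⟩
  · rintro ⟨h1, h2, h3, h4, h5⟩
    exact ⟨h1, by linarith, by linarith, h4, by linarith⟩

/-- `T((3+i)/5)` is the second typed domain of the item. [folklore] -/
theorem idealTetrahedron_param₂ : idealTetrahedron ⟨3 / 5, 1 / 5⟩ =
    {p | 0 < p 1 ∧ 3 * p 1 < p 0 ∧ p 0 - 1 < -2 * p 1 ∧ 0 < p 2 ∧
      0 < p 0 ^ 2 + p 1 ^ 2 + p 2 ^ 2 - p 0 + p 1} := by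
  rw [idealTetrahedron_mk]
  ext p
  simp only [mem_setOf_eq]
  constructor
  · rintro ⟨h1, h2, h3, h4, h5⟩
    exact ⟨h1, by linarith, by linarith, h4, by linarith⟩
  · rintro ⟨h1, h2, h3, h4, h5⟩
    exact ⟨h1, by linarith, by linarith, h4, by linarith⟩

/-- `T(2i)` is the third typed domain of the item. [folklore] -/
theorem idealTetrahedron_two_I : idealTetrahedron (2 * I) =
    {p | 0 < p 1 ∧ 0 < p 0 ∧ 2 * p 0 - 2 < -p 1 ∧ 0 < p 2 ∧
      0 < p 0 ^ 2 + p 1 ^ 2 + p 2 ^ 2 - p 0 - 2 * p 1} := by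
  rw [show (2 * I : ℂ) = ⟨0, 2⟩ from by apply Complex.ext <;> simp, idealTetrahedron_mk]
  ext p
  simp only [mem_setOf_eq]
  constructor
  · rintro ⟨h1, h2, h3, h4, h5⟩
    exact ⟨h1, by linarith, by linarith, h4, by linarith⟩
  · rintro ⟨h1, h2, h3, h4, h5⟩
    exact ⟨h1, by linarith, by linarith, h4, by linarith⟩

/-- `T((6+2i)/5)` is the fourth typed domain of the item. [folklore] -/
theorem idealTetrahedron_param₄ : idealTetrahedron ⟨6 / 5, 2 / 5⟩ =
    {p | 0 < p 1 ∧ 3 * p 1 < p 0 ∧ 2 * p 0 - 2 < p 1 ∧ 0 < p 2 ∧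
      0 < p 0 ^ 2 + p 1 ^ 2 + p 2 ^ 2 - p 0 - p 1} := by
  rw [idealTetrahedron_mk]
  ext p
  simp only [mem_setOf_eq]
  constructor
  · rintro ⟨h1, h2, h3, h4, h5⟩
    exact ⟨h1, by linarith, by linarith, h4, by linarith⟩
  · rintro ⟨h1, h2, h3, h4, h5⟩
    exact ⟨h1, by linarith, by linarith, h4, by linarith⟩

/-! ## §2 Representations on a standard tetrahedron are interchangeable modulo relations -/

/-- A representation on `T(z)` (`z` algebraic, `Im z > 0`) with integrand `t⁻³` on its domain differs
from the standard representation `ρ₀ z` by a KZ relation (integrand additivity with a zero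
representation, `KZ.of_sub_of_mem_relations_of_eqOn`). [folklore] -/
theorem of_sub_of_ρ₀_mem_relations {z : ℂ} (hz : IsAlgebraic ℚ z) (him : 0 < z.im)
    (r : IntegralRep 3) (hd : r.domain = idealTetrahedron z)
    (hi : EqOn r.integrand (fun p => 1 / p 2 ^ 3) r.domain) :
    KZ.of r - KZ.of (ρ₀ z) ∈ relations := by
  obtain ⟨hd₀, hi₀⟩ := isStandardOn_ρ₀ z hz him
  refine of_sub_of_mem_relations_of_eqOn (hd₀.trans hd.symm) ?_
  intro p hp
  have hp' : p ∈ idealTetrahedron z := hd ▸ hp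
  rw [hi hp]
  exact (hi₀ hp').symm

/-! ## §3 The item -/

/-- **`FiveTermCalibration`** (stmt-KontsevichZagierPeriods-3476): `[T(i)] + [T((3+i)/5)] − [T(2i)] −
[T((6+2i)/5)] ∈ KZ.relations` for any representations on these four tetrahedra with integrand
`t⁻³` — the instance `(x, y) = (i, 2i)` of `FiveTermTransfer` (the real term `[y/x] = [2]`
vanishes; Neumann 1998, §2 eq. (2.3)). [folklore] -/
theorem fiveTermCalibration_proof : FiveTermCalibration := by
  intro r₁ r₂ r₃ r₄ h₁ h₂ h₃ h₄ e₁ e₂ e₃ e₄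
  have hx : IsAlgebraic ℚ I := isAlgebraic_of_eq_rat 0 1 (by push_cast; ring)
  have hy : IsAlgebraic ℚ (2 * I) := isAlgebraic_of_eq_rat 0 2 (by push_cast; ring)
  -- the five arguments of the five-term element at `(i, 2i)`
  have e3 : 2 * I / I = (2 : ℂ) := by rw [mul_div_assoc, div_self I_ne_zero, mul_one]
  have e4 : (1 - I⁻¹) / (1 - (2 * I)⁻¹) = (⟨6 / 5, 2 / 5⟩ : ℂ) := by
    apply Complex.ext <;> simp [Complex.div_re, Complex.div_im, Complex.normSq_apply] <;> norm_num
  have e5 : (1 - I) / (1 - 2 * I) = (⟨3 / 5, 1 / 5⟩ : ℂ) := by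
    apply Complex.ext <;> simp [Complex.div_re, Complex.div_im, Complex.normSq_apply] <;> norm_num
  have h₂alg : IsAlgebraic ℚ (⟨3 / 5, 1 / 5⟩ : ℂ) := by
    rw [← e5, div_eq_mul_inv]
    exact (isAlgebraic_one.sub hx).mul (isAlgebraic_one.sub hy).inv
  have h₄alg : IsAlgebraic ℚ (⟨6 / 5, 2 / 5⟩ : ℂ) := by
    rw [← e4, div_eq_mul_inv]
    exact (isAlgebraic_one.sub hx.inv).mul (isAlgebraic_one.sub hy.inv).inv
  -- the five-term relation for the standard family `ρ₀` at `(i, 2i)`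
  have key := fiveTermTransfer_iff.mp FiveTermTransfer_of ρ₀ isStandardOn_ρ₀ I (2 * I) hx hy
    I_ne_zero (by intro e; have h := congrArg Complex.im e; norm_num at h)
    (by intro e; have h := congrArg Complex.im e; norm_num at h)
    (by intro e; have h := congrArg Complex.im e; norm_num at h)
    (by intro e; have h := congrArg Complex.im e; norm_num at h)
  unfold fiveTerm at key
  rw [e3, e4, e5, signedClass_of_im_pos _ (z := I) (by simp),
    signedClass_of_im_pos _ (z := 2 * I) (by simp), signedClass_of_im_zero _ (z := 2) (by simp),
    signedClass_of_im_pos _ (z := (⟨6 / 5, 2 / 5⟩ : ℂ)) (by norm_num),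
    signedClass_of_im_pos _ (z := (⟨3 / 5, 1 / 5⟩ : ℂ)) (by norm_num)] at key
  -- each `rₖ` is interchangeable with `ρ₀ zₖ`
  have d₁ := of_sub_of_ρ₀_mem_relations hx (by simp) r₁ (h₁.trans idealTetrahedron_I.symm) e₁
  have d₂ := of_sub_of_ρ₀_mem_relations h₂alg (by norm_num) r₂
    (h₂.trans idealTetrahedron_param₂.symm) e₂
  have d₃ := of_sub_of_ρ₀_mem_relations hy (by simp) r₃ (h₃.trans idealTetrahedron_two_I.symm) e₃
  have d₄ := of_sub_of_ρ₀_mem_relations h₄alg (by norm_num) r₄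
    (h₄.trans idealTetrahedron_param₄.symm) e₄
  have e : KZ.of r₁ + KZ.of r₂ - KZ.of r₃ - KZ.of r₄ =
      (KZ.of r₁ - KZ.of (ρ₀ I)) + (KZ.of r₂ - KZ.of (ρ₀ ⟨3 / 5, 1 / 5⟩))
        - (KZ.of r₃ - KZ.of (ρ₀ (2 * I))) - (KZ.of r₄ - KZ.of (ρ₀ ⟨6 / 5, 2 / 5⟩))
        + (KZ.of (ρ₀ I) - KZ.of (ρ₀ (2 * I)) + 0 - KZ.of (ρ₀ ⟨6 / 5, 2 / 5⟩)
            + KZ.of (ρ₀ ⟨3 / 5, 1 / 5⟩)) := by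
    abel
  rw [e]
  exact add_mem (sub_mem (sub_mem (add_mem d₁ d₂) d₃) d₄) key

end Summit.KontsevichZagierPeriods.HyperbolicBloch.Calibration
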